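import Literature.MathematicalPhysics.QuantumFieldTheory.ConformalBootstrap3D.PointKernelK34v2Data

/-!
# K34v2 certificate, kernel block file H17: head segments `258 ≤ i < 274` (block-checked ones)

`decide` by kernel reduction (no `native_decide`, no extra axioms) of the block checker
`PCert.hBlockOK` of `PointKernel` on the literal data of `PointKernelK34v2Data` (cells checked corner
or chord by the rule bit); soundness is `PCert.hBlockOK_sound`.  Estimated kernel time 235 s
(5 theorems).
-/

set_option maxRecDepth 100000
set_option maxHeartbeats 0

namespace Literature.MathematicalPhysics.QuantumFieldTheory.ConformalBootstrap3D.PointKernelK34v2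

open Literature.MathematicalPhysics.QuantumFieldTheory.ConformalBootstrap3D.PointKernel

/-- head segment `[258, 259)` passes the kernel evaluator (≈35 s of kernel work). [folklore] -/
theorem hBlock_258 : certK34v2.hBlockOK hsegsK34v2 258 259 JHK34v2 = true := by
  decide +kernel

/-- head segment `[259, 260)` passes the kernel evaluator (≈39 s of kernel work). [folklore] -/
theorem hBlock_259 : certK34v2.hBlockOK hsegsK34v2 259 260 JHK34v2 = true := by
  decide +kernel

/-- head segments `[260, 262)` pass the kernel evaluator (≈48 s of kernel work). [folklore] -/
theorem hBlock_260 : certK34v2.hBlockOK hsegsK34v2 260 262 JHK34v2 = true := by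
  decide +kernel

/-- head segments `[262, 265)` pass the kernel evaluator (≈55 s of kernel work). [folklore] -/
theorem hBlock_262 : certK34v2.hBlockOK hsegsK34v2 262 265 JHK34v2 = true := by
  decide +kernel

/-- head segments `[265, 274)` pass the kernel evaluator (≈9 s of kernel work). [folklore] -/
theorem hBlock_265 : certK34v2.hBlockOK hsegsK34v2 265 274 JHK34v2 = true := by
  decide +kernel

end Literature.MathematicalPhysics.QuantumFieldTheory.ConformalBootstrap3D.PointKernelK34v2
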